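import Literature.Analysis.FluidPDE.KNSSLineInvariantLiouville
import Literature.Analysis.FluidPDE.TypeIAncientMild
import Literature.Analysis.FluidPDE.OseenMildUniqueness
import Literature.Analysis.FluidPDE.KNSSOseenMildDecayTools
import Literature.Analysis.FluidPDE.KatoSymmetryCovariance
import HarnessLib

/-!
# Route `ExtremiserTransience`, crux `NearExtremalTransiencePerFlow` (stmt-NavierStokesRegularity-26567) —
# LINE g9-β «filament selection» rev 6 §2d, RUNG R2 «breathing-periodic necklaces are dead» (`BreathingPeriodicLiouville`)

`--supports stmt-NavierStokesRegularity-26567`.  Prover seat ns-net-p2 (g6).  THE STATEMENT (`breathingPeriodicLiouville`, verbatim the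
Prop `BreathingPeriodicLiouville` of `Cruxes/NearExtremalTransiencePerFlow/Lines/filament_selection.lean` rev 6 §2d with
`IsX3Periodic ℓ w := ∀ x, w (x + ℓ • EuclideanSpace.single 2 1) = w x` unfolded): a Type-I ancient mild field `W` (Oseen gauge,
constant `K`) which at every time `τ < 0` is `x₃`-periodic with a period `h τ` depending CONTINUOUSLY and INJECTIVELY on `τ` vanishes
identically.  GROWTH-FREE (no energy, no pressure).

PROOF (the author's three landed inputs).
1. PERIOD PROPAGATION (`period_propagates`): if `ℓ` is an `e`-period of the slice `W τ₀`, it is an `e`-period of every later slice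
   `W τ`, `τ₀ ≤ τ < 0`: the translate `(t, x) ↦ W t (x + ℓ • e)` satisfies the same Oseen integral equation from time `τ₀`
   (`heatFlow_comp_add_right`, `oseenDuhamel_comp_add_right`) with the SAME free term (the slices agree at `τ₀`), both fields are
   bounded by `K/√(-T')` on `(τ₀, T')`, so forward uniqueness of bounded Oseen-mild solutions (`oseenMild_bounded_unique`, KNSS 2009
   §4) identifies them a.e., hence everywhere by continuity.
2. A WHOLE INTERVAL OF PERIODS (`invariant_of_breathing`): at time `τ` the `e₃`-periods of `W τ` contain `h '' [τ - 1, τ]`, which by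
   continuity contains the non-degenerate interval between `h (τ - 1) ≠ h τ` (injectivity; intermediate value theorem); the periods of
   a slice form an additive subgroup of `ℝ`, and a subgroup containing an interval of positive length `d` contains `[-d, d]`, hence
   every real `r = n • (r/n)` (Archimedes): `W τ` is invariant along `e₃`.
3. LIOUVILLE: the bounded time-shifts `W (· - δ)` (`isBoundedAncientMildSolution_sub`) are jointly continuous, `e₃`-invariant bounded
   ancient mild solutions, so their slices are spatially constant (`apply_eq_apply_zero_of_invariant_along`, KNSS 2009 Thm 5.1 in the
   tree's line-invariant form); a slice-constant Type-I ancient mild field is zero (`IsTypeIAncientMild.eq_zero_of_slice_const`).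
HONEST FRAMING: a Liouville-type statement about hypothetical Type-I ancient fields with an exact discrete symmetry; nothing about
Navier–Stokes regularity or blow-up is proved; the heart H′ of the line is untouched; no summit is proved by a line.
[cite: KochNadirashviliSereginSverak2009, §4 (4.3)–(4.4) p. 8, Thm 5.1 p. 9, Remark 6.1 p. 11 (arXiv:0709.3599)]
-/

noncomputable section

open scoped Topology
open MeasureTheory Filter Set Function
open Literature.Analysis Literature.Analysis.FluidPDE

namespace Summit.NavierStokesRegularity.NavierStokesRegularity.Theorems

set_option linter.dupNamespace false

namespace NearExtremalTransiencePerFlow.FilamentSelection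

/-! ### Step 1: periods propagate forward in time -/

/-- **Periods propagate forward.**  If `ℓ • e` is a period of the slice `W τ₀` of a Type-I ancient mild field (`τ₀ < 0`), then it
is a period of `W τ` for every `τ ∈ [τ₀, 0)`: the translate solves the same Oseen integral equation from `τ₀` with the same free
term, and bounded solutions of that equation are unique (KNSS 2009, §4).
[cite: KochNadirashviliSereginSverak2009, §4 (4.3)–(4.4) (arXiv:0709.3599 p. 8)] -/
theorem period_propagates {K : ℝ} {W : ℝ → EuclideanSpace ℝ (Fin 3) → EuclideanSpace ℝ (Fin 3)}
    (hW : IsTypeIAncientMild K W) {e : EuclideanSpace ℝ (Fin 3)} {ℓ τ₀ : ℝ}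
    (hper : ∀ x, W τ₀ (x + ℓ • e) = W τ₀ x) {τ : ℝ} (hτ₀τ : τ₀ ≤ τ) (hτ : τ < 0) :
    ∀ x, W τ (x + ℓ • e) = W τ x := by
  rcases hτ₀τ.eq_or_lt with h | hlt
  · subst h; exact hper
  -- the translate and a window `(τ₀, T')` with `τ < T' < 0`
  set V : ℝ → EuclideanSpace ℝ (Fin 3) → EuclideanSpace ℝ (Fin 3) := fun t x => W t (x + ℓ • e) with hVdef
  set T' : ℝ := τ / 2 with hT'def
  have hT' : T' < 0 := by rw [hT'def]; linarith
  have hτT' : τ < T' := by rw [hT'def]; linarith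
  -- the common bound `M = K/√(-T')` on `(τ₀, T')`
  set M : ℝ := K / Real.sqrt (-T') with hMdef
  have hK : 0 ≤ K := hW.nonneg
  have hM : 0 ≤ M := div_nonneg hK (Real.sqrt_nonneg _)
  have hbdW : ∀ t ∈ Ioo τ₀ T', ∀ y, ‖W t y‖ ≤ M := by
    intro t ht y
    have ht0 : t < 0 := ht.2.trans hT'
    refine (hW.norm_le ht0 y).trans ?_
    exact div_le_div_of_nonneg_left hK (Real.sqrt_pos.2 (neg_pos.2 hT'))
      (Real.sqrt_le_sqrt (by linarith [ht.2]))
  have hbdV : ∀ t ∈ Ioo τ₀ T', ∀ y, ‖V t y‖ ≤ M := fun t ht y => hbdW t ht _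
  -- joint measurability on the window
  have hcontW : ContinuousOn (uncurry W) (Ioo τ₀ T' ×ˢ univ) :=
    hW.continuousOn_uncurry.mono (prod_mono (fun t ht => ht.2.trans hT') Subset.rfl)
  have hmW : AEStronglyMeasurable (uncurry W) ((volume : Measure (ℝ × EuclideanSpace ℝ (Fin 3))).restrict (Ioo τ₀ T' ×ˢ univ)) :=
    hcontW.aestronglyMeasurable (measurableSet_Ioo.prod MeasurableSet.univ)
  have hcontV : ContinuousOn (uncurry V) (Ioo τ₀ T' ×ˢ univ) := by
    have h1 : ContinuousOn (fun q : ℝ × EuclideanSpace ℝ (Fin 3) => (q.1, q.2 + ℓ • e)) (Ioo τ₀ T' ×ˢ univ) :=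
      (continuous_fst.prodMk (continuous_snd.add continuous_const)).continuousOn
    exact hcontW.comp h1 fun q hq => ⟨hq.1, mem_univ _⟩
  have hmV : AEStronglyMeasurable (uncurry V) ((volume : Measure (ℝ × EuclideanSpace ℝ (Fin 3))).restrict (Ioo τ₀ T' ×ˢ univ)) :=
    hcontV.aestronglyMeasurable (measurableSet_Ioo.prod MeasurableSet.univ)
  -- both solve the Oseen equation from `τ₀` with the free term `e^{(t-τ₀)Δ} W τ₀`
  have hWeq : ∀ t ∈ Ioo τ₀ T', W t =ᵐ[volume] fun x => heatFlow (W τ₀) (t - τ₀) x - oseenDuhamel 1 τ₀ W W t x :=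
    fun t ht => Eventually.of_forall fun x => hW.mild_eq ht.1 (ht.2.trans hT') x
  have hVeq : ∀ t ∈ Ioo τ₀ T', V t =ᵐ[volume] fun x => heatFlow (W τ₀) (t - τ₀) x - oseenDuhamel 1 τ₀ V V t x := by
    intro t ht
    refine Eventually.of_forall fun x => ?_
    have h1 := hW.mild_eq ht.1 (ht.2.trans hT') (x + ℓ • e)
    have h2 : heatFlow (W τ₀) (t - τ₀) (x + ℓ • e) = heatFlow (fun y => W τ₀ (y + ℓ • e)) (t - τ₀) x :=
      (heatFlow_comp_add_right (W τ₀) (ℓ • e) (t - τ₀) x).symm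
    have h3 : (fun y => W τ₀ (y + ℓ • e)) = W τ₀ := funext hper
    have h4 : oseenDuhamel 1 τ₀ W W t (x + ℓ • e) = oseenDuhamel 1 τ₀ V V t x :=
      (oseenDuhamel_comp_add_right 1 τ₀ W W (ℓ • e) t x).symm
    show W t (x + ℓ • e) = heatFlow (W τ₀) (t - τ₀) x - oseenDuhamel 1 τ₀ V V t x
    rw [h1, h2, h3, h4]
  have huniq := oseenMild_bounded_unique (u := V) (v := W) one_pos hM hmV hmW hbdV hbdW hVeq hWeq τ ⟨hlt, hτT'⟩
  -- a.e. equal continuous slices are equal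
  have hcW : Continuous (W τ) := hW.continuous_slice hτ
  have hcV : Continuous (V τ) := hcW.comp (continuous_id.add continuous_const)
  have heq : V τ = W τ := (Continuous.ae_eq_iff_eq volume hcV hcW).1 huniq
  intro x
  exact congrFun heq x

/-! ### Step 2: a continuous injective period law forces invariance along `e₃` -/

/-- The periods (along a fixed vector `e`) of a function are closed under natural multiples. [folklore] -/
private theorem nsmul_period {w : EuclideanSpace ℝ (Fin 3) → EuclideanSpace ℝ (Fin 3)} {e : EuclideanSpace ℝ (Fin 3)}
    {r : ℝ} (hr : ∀ x, w (x + r • e) = w x) : ∀ (n : ℕ) (x), w (x + ((n : ℝ) * r) • e) = w x := by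
  intro n
  induction n with
  | zero => intro x; simp
  | succ n ih =>
    intro x
    have e1 : x + (((n + 1 : ℕ) : ℝ) * r) • e = (x + ((n : ℝ) * r) • e) + r • e := by
      rw [Nat.cast_succ, add_mul, one_mul, add_smul, add_assoc]
    rw [e1, hr, ih]

/-- **Invariance along `e₃` from a breathing period law.**  If every slice `W τ` (`τ < 0`) of a Type-I ancient mild field is
periodic along `e` with period `h τ`, `h` continuous and injective on `(-∞, 0)`, then every slice is invariant under ALL translations
along `e`: the periods of `W τ` contain `h '' [τ-1, τ]` (Step 1), a non-degenerate interval, and an additive subgroup of `ℝ`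
containing an interval is `ℝ`. [cite: KochNadirashviliSereginSverak2009, §4 (arXiv:0709.3599 p. 8)] -/
theorem invariant_of_breathing {K : ℝ} {W : ℝ → EuclideanSpace ℝ (Fin 3) → EuclideanSpace ℝ (Fin 3)}
    (hW : IsTypeIAncientMild K W) {e : EuclideanSpace ℝ (Fin 3)} {h : ℝ → ℝ}
    (hcont : ContinuousOn h (Set.Iio 0)) (hinj : Set.InjOn h (Set.Iio 0))
    (hper : ∀ τ : ℝ, τ < 0 → ∀ x, W τ (x + h τ • e) = W τ x) :
    ∀ τ : ℝ, τ < 0 → ∀ (x : EuclideanSpace ℝ (Fin 3)) (r : ℝ), W τ (x + r • e) = W τ x := by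
  intro τ hτ
  -- the period set of the slice `W τ`
  set P : Set ℝ := {r | ∀ x, W τ (x + r • e) = W τ x} with hPdef
  have hP0 : (0 : ℝ) ∈ P := fun x => by simp
  have hPadd : ∀ {a b : ℝ}, a ∈ P → b ∈ P → a + b ∈ P := by
    intro a b ha hb x
    have e1 : x + (a + b) • e = (x + b • e) + a • e := by rw [add_smul]; abel
    rw [e1, ha, hb]
  have hPneg : ∀ {a : ℝ}, a ∈ P → -a ∈ P := by
    intro a ha x
    have e1 := ha (x + (-a) • e)
    rw [add_assoc, ← add_smul, neg_add_cancel, zero_smul, add_zero] at e1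
    exact e1.symm
  have hPsub : ∀ {a b : ℝ}, a ∈ P → b ∈ P → a - b ∈ P := fun ha hb => by
    rw [sub_eq_add_neg]; exact hPadd ha (hPneg hb)
  -- Step 1: every `h τ₀`, `τ₀ ∈ [τ-1, τ]`, is a period of `W τ`
  have hprop : ∀ τ₀ ∈ Icc (τ - 1) τ, h τ₀ ∈ P := fun τ₀ hτ₀ =>
    period_propagates hW (hper τ₀ (by linarith [hτ₀.2])) hτ₀.2 hτ
  -- the image `h '' [τ-1, τ]` contains the interval between `h (τ-1)` and `h τ`
  have hcI : ContinuousOn h (Icc (τ - 1) τ) := hcont.mono fun t ht => by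
    show t < 0; linarith [ht.2]
  have hne : h (τ - 1) ≠ h τ := fun heq =>
    absurd (hinj (show τ - 1 < 0 by linarith) hτ heq) (by linarith)
  -- an interval `[α, α + d] ⊆ P` with `0 < d`
  obtain ⟨α, d, hd, hαP⟩ : ∃ α d : ℝ, 0 < d ∧ ∀ r ∈ Icc α (α + d), r ∈ P := by
    rcases lt_or_gt_of_ne hne with hlt | hgt
    · refine ⟨h (τ - 1), h τ - h (τ - 1), sub_pos.2 hlt, fun r hr => ?_⟩
      have hr' : r ∈ Icc (h (τ - 1)) (h τ) := ⟨hr.1, by linarith [hr.2]⟩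
      obtain ⟨τ₀, hτ₀, rfl⟩ := intermediate_value_Icc (by linarith) hcI hr'
      exact hprop τ₀ hτ₀
    · refine ⟨h τ, h (τ - 1) - h τ, sub_pos.2 hgt, fun r hr => ?_⟩
      have hr' : r ∈ Icc (h τ) (h (τ - 1)) := ⟨hr.1, by linarith [hr.2]⟩
      obtain ⟨τ₀, hτ₀, rfl⟩ := intermediate_value_Icc' (by linarith) hcI hr'
      exact hprop τ₀ hτ₀
  -- hence `[-d, d] ⊆ P`
  have hsmall : ∀ r ∈ Icc (-d) d, r ∈ P := by
    intro r hr
    rcases le_or_gt 0 r with h0 | h0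
    · have h1 : α + r ∈ P := hαP _ ⟨by linarith, by linarith [hr.2]⟩
      have h2 : α ∈ P := hαP _ ⟨le_rfl, by linarith⟩
      have h3 := hPsub h1 h2
      rwa [add_sub_cancel_left] at h3
    · have h1 : α + -r ∈ P := hαP _ ⟨by linarith, by linarith [hr.1]⟩
      have h2 : α ∈ P := hαP _ ⟨le_rfl, by linarith⟩
      have h3 := hPsub h1 h2
      rw [add_sub_cancel_left] at h3
      have h4 := hPneg h3
      rwa [neg_neg] at h4
  -- and every real number: `r = n • (r/n)` with `r/n ∈ [-d, d]` (Archimedes)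
  intro x r
  obtain ⟨n, hn⟩ := exists_nat_gt (|r| / d)
  have hn0 : 0 < (n : ℝ) := lt_of_le_of_lt (by positivity) hn
  have hrn : r / n ∈ Icc (-d) d := by
    have h1 : |r| < n * d := by rwa [div_lt_iff₀ hd] at hn
    have h2 : |r / n| ≤ d := by
      rw [abs_div, abs_of_pos hn0, div_le_iff₀ hn0]
      linarith [mul_comm (n : ℝ) d]
    exact ⟨by linarith [neg_abs_le (r / n), h2], (le_abs_self _).trans h2⟩
  have hkey := nsmul_period (hsmall _ hrn) n x
  rwa [mul_div_cancel₀ r hn0.ne'] at hkey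

/-! ### Step 3: the Liouville theorem -/

/-- **RUNG R2 `BreathingPeriodicLiouville` — breathing-periodic Type-I ancient mild fields are zero** (verbatim the Prop of
`Cruxes/NearExtremalTransiencePerFlow/Lines/filament_selection.lean` rev 6 §2d with `IsX3Periodic` unfolded; GROWTH-FREE).  A Type-I
ancient mild field whose slice at each `τ < 0` is `x₃`-periodic with a period `h τ`, `h` continuous and injective on `(-∞,0)`, vanishes
identically: Steps 1–2 make every slice invariant along `e₃`; the tree's line-invariant Liouville theorem
(`apply_eq_apply_zero_of_invariant_along`, on the bounded time-shifts `W (· - δ)`) makes the slices spatially constant, and a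
slice-constant Type-I ancient mild field is zero (`IsTypeIAncientMild.eq_zero_of_slice_const`).
[cite: KochNadirashviliSereginSverak2009, Thm 5.1 (arXiv:0709.3599 p. 9) and Remark 6.1 (p. 11)] -/
theorem breathingPeriodicLiouville :
    ∀ (K : ℝ) (W : ℝ → EuclideanSpace ℝ (Fin 3) → EuclideanSpace ℝ (Fin 3)) (h : ℝ → ℝ),
      Literature.Analysis.FluidPDE.IsTypeIAncientMild K W →
      ContinuousOn h (Set.Iio 0) → Set.InjOn h (Set.Iio 0) →
      (∀ τ : ℝ, τ < 0 → ∀ x, W τ (x + h τ • EuclideanSpace.single (2 : Fin 3) (1 : ℝ)) = W τ x) →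
      ∀ τ : ℝ, τ < 0 → ∀ x, W τ x = 0 := by
  intro K W h hW hcont hinj hper
  set e : EuclideanSpace ℝ (Fin 3) := EuclideanSpace.single (2 : Fin 3) (1 : ℝ) with hedef
  have he : e ≠ 0 := fun h0 => by
    have : e 2 = 0 := by rw [h0]; rfl
    simp [hedef] at this
  -- Step 2: invariance along `e₃` at every negative time
  have hinv : ∀ τ : ℝ, τ < 0 → ∀ (x : EuclideanSpace ℝ (Fin 3)) (r : ℝ), W τ (x + r • e) = W τ x :=
    invariant_of_breathing hW hcont hinj hper
  -- Step 3: slices are spatially constant (Liouville on the bounded time-shifts), hence zero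
  have hconst : ∀ τ < 0, ∀ x, W τ x = W τ 0 := by
    intro τ hτ x
    set δ : ℝ := -τ / 2 with hδdef
    have hδ : 0 < δ := by rw [hδdef]; linarith
    have hB := hW.isBoundedAncientMildSolution_sub hδ
    have hC : ContinuousOn (uncurry fun t => W (t - δ)) (Iio 0 ×ˢ univ) := by
      have h1 : ContinuousOn (fun q : ℝ × EuclideanSpace ℝ (Fin 3) => (q.1 - δ, q.2)) (Iio 0 ×ˢ univ) :=
        ((continuous_fst.sub continuous_const).prodMk continuous_snd).continuousOn
      refine hW.continuousOn_uncurry.comp h1 fun q hq => ⟨?_, mem_univ _⟩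
      show q.1 - δ < 0
      have : q.1 < 0 := hq.1
      linarith
    have hI : ∀ t < 0, ∀ (x : EuclideanSpace ℝ (Fin 3)) (r : ℝ), (fun t => W (t - δ)) t (x + r • e) = (fun t => W (t - δ)) t x :=
      fun t ht x r => hinv (t - δ) (by linarith) x r
    have key := apply_eq_apply_zero_of_invariant_along he hB hC hI (τ + δ) (by rw [hδdef]; linarith) x
    simpa only [add_sub_cancel_right] using key
  intro τ hτ x
  exact hW.eq_zero_of_slice_const (b := fun t => W t 0) (fun t ht y => hconst t ht y) hτ x

end NearExtremalTransiencePerFlow.FilamentSelection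

end Summit.NavierStokesRegularity.NavierStokesRegularity.Theorems

end
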